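import Literature.NumberTheory.Rogawski1990.RankOneUnstableTransferNonsplitCMOfCore   -- ★ p843033 A-p19 (g22): `normOne_frame_of_mem_centralizer`; brings ★ `finCharpolyTwo_eq_of_frame`, ★ `continuous_fst_localMatrix`, ★ `isUnit_localRing_of_ne_zero_of_subsingleton`
import Literature.NumberTheory.Rogawski1990.FinExplicitTransferFactorEventuallyConst  -- ★ `finHeckeValue_eventually_eq` (`μ_v` is constant near every unit)
import Literature.NumberTheory.Rogawski1990.RankOneUnstableTransferInertCoreAssembly -- ★ p843388 F0P3-p01 (g13) LAYER 2b: `conjLocal_frameEntry_mul_self`, `frameEntry_zero_ne_one_of_isRegularElt`, the depth `N t := (−log v_w(τ₀ t − τ₁ t)).toNat` in closed form `valued_frameEntry_sub_eq_pow`; brings ★ p843099 (I-4b) and ★ `valued_toPlace_uniformizer_of_isUnramifiedIn`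
import HarnessLib

/-!
# «TORUS CONTINUITY PACK» for the (R1-core) eventual-constancy layer: the frame eigenvalues `τᵢ(t)` along the compact torus `Z(t₀) ⊂ H_v`,
# their depth `ord_w(τ₀ − τ₁)` near the singular sub-torus, and the local constancy of `μ_v(τᵢ)` (road «R1LL-tree»; Rogawski 1990 Lemma 4.9.3; Labesse–Langlands §2)

Topic `NumberTheory/Rogawski1990`; namespace `Literature.NumberTheory.Rogawski1990`.  THEOREMS ONLY (no definition, no instance, no notation, no named fact,
no `sorry`).  Cell `pub/hodgecm-mathlib` (D-0151), crux H413 = `stmt-HodgeConjecture-24833`, line «N6nsGerm» stub `stub_N6nsR1LL`, road «R1LL-tree»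
(LEAD F0P3a-plan (g10) WORD T9-8 (A); architect A-p16 (g27) RULING A-9 (b3) «TORUS CONTINUITY PACK», hand F0P3a-p03 (g12)).

CONSUMER.  ★ `exists_eventually_mul_eq_const_of_depthExpansion` ∕ `forall_…` (F0P3-p01 (g13), LAYER 2a, p843155) is abstract over a space `X`, its regular
locus `U`, a depth `N : X → ℕ` and coefficient functions, and asks for the binders
`hN : ∀ s ∉ U, ∀ M, ∀ᶠ t in 𝓝 s, t ∈ U → M ≤ N t`, `hE : ∀ s ∉ U, ∀ᶠ t in 𝓝 s, t ∈ U → E t = E s`, `hφm`∕`hφ` (same shape for the coefficient functions).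
Here `X = ↥Z(t₀)` is the centraliser torus of an elliptic regular `t₀ ∈ H_v = U(Φ₂)(L⁺_v) × U(Φ₁)(L⁺_v)` at a NON-SPLIT finite place, framed by `t₀.1·P = P·diag d`
with norm-one `d` (★ `normOne_frame_of_mem_centralizer`: every `t ∈ Z(t₀)` is `P·diag(τ₀ t, τ₁ t)·P⁻¹` with NORM-ONE `τᵢ t := (P⁻¹ t.1 P)ᵢᵢ`), `U = {t | t.1 regular}`,
`E t = μ_v(τ₁ t)⁻¹ · C⁻¹` (A-9 (b2)), and `N t = ord_w(τ₀ t − τ₁ t)` read through `Valued.v ((τ₀ t − τ₁ t) w) = Valued.v ϖ_w ^ (N t)` (LAYER 2b picks `N` by `Nat.find`;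
this file stays in VALUATION currency and never names `N`).  WHAT IS PROVED (all elementary topology of the local field `E_v = L_w`):
* §1 value-group bookkeeping: `u ^ n < u ^ M ⇒ M < n` for `u ≤ 1` ((iv) — a locally constant function of a continuous argument is eventually constant — is
  Mathlib's `IsLocallyConstant.comp_continuous` ∕ `Filter.Tendsto.eventually`, kept private here);
* §2 (i) the frame entries `a ↦ (P⁻¹ a.1 P) i j` are continuous on `H_v` (and componentwise at every `w′ ∣ v`), with the place-`w` valuation∕norm consequences that
  need no frame hypothesis: depth `→ ∞` where `τ₀ = τ₁` (`eventually_valued_frameEntry_sub_lt`: `< Valued.v π` for every `π ≠ 0`), valuation∕norm∕`μ_v(τ₀ − τ₁)` locally constant where `τ₀ ≠ τ₁`;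
* §3 on `Z(t₀)` under the frame hypotheses: `τᵢ t` is a norm-one unit; **`t.1` is regular ⇔ `τ₀ t ≠ τ₁ t`** (★ `finCharpolyTwo_eq_of_frame`, `E_v` is a field at a
  non-split place); `hE` UNCONDITIONALLY in `U`: `t ↦ μ_v(τᵢ t)` is eventually constant at EVERY `s ∈ Z(t₀)` (★ `finHeckeValue_eventually_eq` at the unit `τᵢ s`),
  hence so is `E t = μ_v(τ₁ t)⁻¹ · C⁻¹`; the `IsRegularElt` readings of the depth statements (`s ∉ U` ∕ `s ∈ U`); and, at an UNRAMIFIED `v`, the LITERAL `hN` binder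
  for the road's depth function `N t = (−log v_w((τ₀ t − τ₁ t)_w)).toNat` of ★ `valued_frameEntry_sub_eq_pow` (F0P3-p01 (g13), LAYER 2b p843388):
  `∀ M, ∀ᶠ t in 𝓝 s, t ∈ U → M ≤ N t` at singular `s` (`eventually_le_depth_of_not_isRegularElt`), and `N` locally constant on `U` (`eventually_depth_eq_of_isRegularElt`).
HONEST LABEL: HC_CM is proved only modulo the printed citations (2 remaining named inputs hLiu418, h413) until rung 0 closes; pure bookkeeping, no arithmetic input.

## References
* [Rogawski1990] J. D. Rogawski, *Automorphic Representations of Unitary Groups in Three Variables*, Ann. of Math. Stud. 123 (1990): §4.9 Lemma 4.9.3, (4.9.2) p. 56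
  (the κ-orbital integral near the singular sub-torus); §3.6 pp. 31–32 (elliptic tori of `U(2)`).
* [LabesseLanglands1979] J.-P. Labesse, R. P. Langlands, *L-indistinguishability for SL(2)*, Canad. J. Math. 31 (1979): §2 (germs of the unstable orbital integral).
* [CasselsFrohlichANT1967] J. W. S. Cassels, A. Fröhlich (eds.), *Algebraic Number Theory* (1967): Ch. II §10 (`E ⊗ F_v = E_w` at a non-split place; the valuation topology).
-/

set_option autoImplicit false

noncomputable section

open Set Filter Topology NumberField IsDedekindDomain Polynomial
open scoped Matrix MatrixGroups

namespace Literature.NumberTheory.Rogawski1990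

open Literature.NumberTheory.Automorphic Literature.NumberTheory.Automorphic.UnitaryGroup Literature.NumberTheory.GaloisRepresentations

/-! ## §1 Generic: eventual constancy of a composite (private); value-group bookkeeping -/

section Generic

variable {α β γ : Type*} [TopologicalSpace α] [TopologicalSpace β]

/-- A function of a continuous argument is eventually constant where the outer function is: if `g` is eventually equal to `g (c s)` near `c s` and `c` is
continuous, then `t ↦ g (c t)` is eventually equal to `g (c s)` near `s` (Mathlib `Filter.Tendsto.eventually`; for a locally constant `g` this is
`IsLocallyConstant.comp_continuous`, the shape of the `hφ`∕`hφm` binders). [folklore] -/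
private theorem eventually_eq_comp_of_continuous {g : β → γ} {c : α → β} (hc : Continuous c) (s : α) (hg : ∀ᶠ y in 𝓝 (c s), g y = g (c s)) :
    ∀ᶠ t in 𝓝 s, g (c t) = g (c s) :=
  (hc.tendsto s).eventually hg

/-- **Powers of an element `≤ 1` of the value group detect the exponent**: `u ^ n < u ^ M ⇒ M < n` (the value group of a discrete valuation is ordered by the exponent
of the uniformiser; used with `u = Valued.v ϖ_w`, `Valued.v ((τ₀ t − τ₁ t) w) = u ^ (N t)`: an eventual bound `< u ^ M` forces `M < N t`). [cite: CasselsFrohlichANT1967, Ch. I §1] -/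
theorem lt_of_pow_lt_pow_of_le_one {Γ₀ : Type*} [LinearOrderedCommGroupWithZero Γ₀] {u : Γ₀} (hu1 : u ≤ 1) {n M : ℕ} (h : u ^ n < u ^ M) : M < n := by
  by_contra hMn
  exact (not_le_of_gt h) (pow_le_pow_right_of_le_one' hu1 (not_lt.1 hMn))

end Generic

/-! ## §2 (i) Continuity of the frame entries `a ↦ (P⁻¹ · a.1 · P) i j` on `H_v`, and what follows at the place `w` without frame hypotheses -/

section Frame

variable (L : Type) [Field L] [NumberField L] [IsCMField L] (v : HeightOneSpectrum (𝓞 ↥(maximalRealSubfield L)))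

/-- **The frame entries `a ↦ (P⁻¹ a.1 P)ᵢⱼ` are continuous on `H_v`** (★ `continuous_fst_localMatrix`; matrix products with constant matrices). [cite: Rogawski1990, §3.6 pp. 31–32] -/
theorem continuous_frameEntry (P : GL (Fin 2) (LocalRing L v)) (i j : Fin 2) :
    Continuous fun a : ((cmDatum L 2 (Matrix.of fun i j : Fin 2 => if i.val + j.val + 1 = 2 then (1 : L) else 0)).Local v × (cmDatum L 1 (Matrix.of fun i j : Fin 1 => if i.val + j.val + 1 = 1 then (1 : L) else 0)).Local v) => ((P⁻¹).val * (a.1.val.val : Matrix (Fin 2) (Fin 2) (LocalRing L v)) * P.val) i j :=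
  ((continuous_const.matrix_mul (continuous_fst_localMatrix L v)).matrix_mul continuous_const).matrix_elem i j

/-- Componentwise (at a place `w′ ∣ v`) continuity of the frame entries. [cite: Rogawski1990, §3.6 pp. 31–32] -/
theorem continuous_frameEntry_apply (P : GL (Fin 2) (LocalRing L v)) (i j : Fin 2) (w' : PlacesOver L v) :
    Continuous fun a : ((cmDatum L 2 (Matrix.of fun i j : Fin 2 => if i.val + j.val + 1 = 2 then (1 : L) else 0)).Local v × (cmDatum L 1 (Matrix.of fun i j : Fin 1 => if i.val + j.val + 1 = 1 then (1 : L) else 0)).Local v) => (((P⁻¹).val * (a.1.val.val : Matrix (Fin 2) (Fin 2) (LocalRing L v)) * P.val) i j) w' :=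
  (continuous_apply w').comp (continuous_frameEntry L v P i j)

/-- The difference of the two diagonal frame entries is continuous (the function `a ↦ τ₀ − τ₁` whose valuation is the depth). [cite: Rogawski1990, §4.9 p. 56] -/
theorem continuous_frameEntry_sub (P : GL (Fin 2) (LocalRing L v)) :
    Continuous fun a : ((cmDatum L 2 (Matrix.of fun i j : Fin 2 => if i.val + j.val + 1 = 2 then (1 : L) else 0)).Local v × (cmDatum L 1 (Matrix.of fun i j : Fin 1 => if i.val + j.val + 1 = 1 then (1 : L) else 0)).Local v) => ((P⁻¹).val * (a.1.val.val : Matrix (Fin 2) (Fin 2) (LocalRing L v)) * P.val) 0 0 - ((P⁻¹).val * (a.1.val.val : Matrix (Fin 2) (Fin 2) (LocalRing L v)) * P.val) 1 1 :=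
  (continuous_frameEntry L v P 0 0).sub (continuous_frameEntry L v P 1 1)

/-- Continuity on the torus `Z(t₀)` of the depth argument `t ↦ (τ₀ t − τ₁ t) w ∈ L_w`. [cite: Rogawski1990, §4.9 p. 56] -/
theorem continuous_frameEntry_sub_apply_centralizer (P : GL (Fin 2) (LocalRing L v)) (w : PlacesOver L v) (t₀ : ((cmDatum L 2 (Matrix.of fun i j : Fin 2 => if i.val + j.val + 1 = 2 then (1 : L) else 0)).Local v × (cmDatum L 1 (Matrix.of fun i j : Fin 1 => if i.val + j.val + 1 = 1 then (1 : L) else 0)).Local v)) :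
    Continuous fun t : ↥(Subgroup.centralizer ({t₀} : Set ((cmDatum L 2 (Matrix.of fun i j : Fin 2 => if i.val + j.val + 1 = 2 then (1 : L) else 0)).Local v × (cmDatum L 1 (Matrix.of fun i j : Fin 1 => if i.val + j.val + 1 = 1 then (1 : L) else 0)).Local v))) => (((P⁻¹).val * ((t : ((cmDatum L 2 (Matrix.of fun i j : Fin 2 => if i.val + j.val + 1 = 2 then (1 : L) else 0)).Local v × (cmDatum L 1 (Matrix.of fun i j : Fin 1 => if i.val + j.val + 1 = 1 then (1 : L) else 0)).Local v)).1.val.val : Matrix (Fin 2) (Fin 2) (LocalRing L v)) * P.val) 0 0 - ((P⁻¹).val * ((t : ((cmDatum L 2 (Matrix.of fun i j : Fin 2 => if i.val + j.val + 1 = 2 then (1 : L) else 0)).Local v × (cmDatum L 1 (Matrix.of fun i j : Fin 1 => if i.val + j.val + 1 = 1 then (1 : L) else 0)).Local v)).1.val.val : Matrix (Fin 2) (Fin 2) (LocalRing L v)) * P.val) 1 1) w :=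
  (continuous_apply w).comp ((continuous_frameEntry_sub L v P).comp continuous_subtype_val)

omit [IsCMField L] in
/-- **The normalised absolute value of the local field `L_w` is locally constant off `0`** (a non-archimedean absolute value takes the value `|x|` on the ball
`|y − x| < |x|`; Mathlib `Valued.locally_const`, `Valued.toNormedField.norm_le_iff`). [cite: CasselsFrohlichANT1967, Ch. II §1] -/
theorem norm_eventually_eq_of_ne_zero_adicCompletion (w₁ : HeightOneSpectrum (𝓞 L)) {x : w₁.adicCompletion L} (hx : x ≠ 0) :
    ∀ᶠ y in 𝓝 x, ‖y‖ = ‖x‖ := by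
  have hv : (Valued.v x : WithZero (Multiplicative ℤ)) ≠ 0 := (Valuation.ne_zero_iff _).2 hx
  filter_upwards [Valued.locally_const hv] with y hy
  refine le_antisymm ?_ ?_
  · rw [Valued.toNormedField.norm_le_iff]; exact hy.le
  · rw [Valued.toNormedField.norm_le_iff]; exact hy.ge

/-- At a non-split place an element of `E_v = Π_{w′ ∣ v} L_{w′}` is read at the one place `w`: `x ≠ y ⇔ x w ≠ y w` (★ `LocalRing.eq_iff_apply_eq`).
[cite: CasselsFrohlichANT1967, Ch. II §10] -/
theorem localRing_ne_iff_apply_ne (w : PlacesOver L v) (hw : IsCMField.complexConj L • w.1 = w.1) (x y : LocalRing L v) : x ≠ y ↔ x w ≠ y w :=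
  not_congr (LocalRing.eq_iff_apply_eq (IsCMField.complexConj L) (IsCMField.complexConj_ne_one L) w hw x y)

/-- **DEPTH `→ ∞` WHERE `τ₀ = τ₁`** (valuation currency, no frame hypothesis needed): at `s ∈ Z(t₀)` with `τ₀ s = τ₁ s`, for every non-zero `π ∈ L_w`,
eventually `Valued.v ((τ₀ t − τ₁ t) w) < Valued.v π` — the depth argument is continuous and vanishes at `s`; read through the normalised absolute value of `L_w`
(`‖·‖ < ‖π‖` near `0`, Mathlib `Valued.toNormedField.norm_lt_iff`).  This is the `hN` binder of ★ `exists_eventually_mul_eq_const_of_depthExpansion` before the road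
names `N t = ord_w`. [cite: Rogawski1990, §4.9 Lemma 4.9.3 (4.9.2) p. 56] [cite: LabesseLanglands1979, §2] -/
theorem eventually_valued_frameEntry_sub_lt (P : GL (Fin 2) (LocalRing L v)) (w : PlacesOver L v) (t₀ : ((cmDatum L 2 (Matrix.of fun i j : Fin 2 => if i.val + j.val + 1 = 2 then (1 : L) else 0)).Local v × (cmDatum L 1 (Matrix.of fun i j : Fin 1 => if i.val + j.val + 1 = 1 then (1 : L) else 0)).Local v)) (s : ↥(Subgroup.centralizer ({t₀} : Set ((cmDatum L 2 (Matrix.of fun i j : Fin 2 => if i.val + j.val + 1 = 2 then (1 : L) else 0)).Local v × (cmDatum L 1 (Matrix.of fun i j : Fin 1 => if i.val + j.val + 1 = 1 then (1 : L) else 0)).Local v))))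
    (hs : ((P⁻¹).val * ((s : ((cmDatum L 2 (Matrix.of fun i j : Fin 2 => if i.val + j.val + 1 = 2 then (1 : L) else 0)).Local v × (cmDatum L 1 (Matrix.of fun i j : Fin 1 => if i.val + j.val + 1 = 1 then (1 : L) else 0)).Local v)).1.val.val : Matrix (Fin 2) (Fin 2) (LocalRing L v)) * P.val) 0 0 = ((P⁻¹).val * ((s : ((cmDatum L 2 (Matrix.of fun i j : Fin 2 => if i.val + j.val + 1 = 2 then (1 : L) else 0)).Local v × (cmDatum L 1 (Matrix.of fun i j : Fin 1 => if i.val + j.val + 1 = 1 then (1 : L) else 0)).Local v)).1.val.val : Matrix (Fin 2) (Fin 2) (LocalRing L v)) * P.val) 1 1) (π : w.1.adicCompletion L) (hπ : π ≠ 0) :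
    ∀ᶠ (t : ↥(Subgroup.centralizer ({t₀} : Set ((cmDatum L 2 (Matrix.of fun i j : Fin 2 => if i.val + j.val + 1 = 2 then (1 : L) else 0)).Local v × (cmDatum L 1 (Matrix.of fun i j : Fin 1 => if i.val + j.val + 1 = 1 then (1 : L) else 0)).Local v)))) in 𝓝 s, Valued.v ((((P⁻¹).val * ((t : ((cmDatum L 2 (Matrix.of fun i j : Fin 2 => if i.val + j.val + 1 = 2 then (1 : L) else 0)).Local v × (cmDatum L 1 (Matrix.of fun i j : Fin 1 => if i.val + j.val + 1 = 1 then (1 : L) else 0)).Local v)).1.val.val : Matrix (Fin 2) (Fin 2) (LocalRing L v)) * P.val) 0 0 - ((P⁻¹).val * ((t : ((cmDatum L 2 (Matrix.of fun i j : Fin 2 => if i.val + j.val + 1 = 2 then (1 : L) else 0)).Local v × (cmDatum L 1 (Matrix.of fun i j : Fin 1 => if i.val + j.val + 1 = 1 then (1 : L) else 0)).Local v)).1.val.val : Matrix (Fin 2) (Fin 2) (LocalRing L v)) * P.val) 1 1) w) < Valued.v π := by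
  have hc := continuous_frameEntry_sub_apply_centralizer L v P w t₀
  have h0 : (((P⁻¹).val * ((s : ((cmDatum L 2 (Matrix.of fun i j : Fin 2 => if i.val + j.val + 1 = 2 then (1 : L) else 0)).Local v × (cmDatum L 1 (Matrix.of fun i j : Fin 1 => if i.val + j.val + 1 = 1 then (1 : L) else 0)).Local v)).1.val.val : Matrix (Fin 2) (Fin 2) (LocalRing L v)) * P.val) 0 0 - ((P⁻¹).val * ((s : ((cmDatum L 2 (Matrix.of fun i j : Fin 2 => if i.val + j.val + 1 = 2 then (1 : L) else 0)).Local v × (cmDatum L 1 (Matrix.of fun i j : Fin 1 => if i.val + j.val + 1 = 1 then (1 : L) else 0)).Local v)).1.val.val : Matrix (Fin 2) (Fin 2) (LocalRing L v)) * P.val) 1 1) w = 0 := by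
    rw [Pi.sub_apply, hs, sub_self]
  have ht : Tendsto (fun t : ↥(Subgroup.centralizer ({t₀} : Set ((cmDatum L 2 (Matrix.of fun i j : Fin 2 => if i.val + j.val + 1 = 2 then (1 : L) else 0)).Local v × (cmDatum L 1 (Matrix.of fun i j : Fin 1 => if i.val + j.val + 1 = 1 then (1 : L) else 0)).Local v))) => (((P⁻¹).val * ((t : ((cmDatum L 2 (Matrix.of fun i j : Fin 2 => if i.val + j.val + 1 = 2 then (1 : L) else 0)).Local v × (cmDatum L 1 (Matrix.of fun i j : Fin 1 => if i.val + j.val + 1 = 1 then (1 : L) else 0)).Local v)).1.val.val : Matrix (Fin 2) (Fin 2) (LocalRing L v)) * P.val) 0 0 - ((P⁻¹).val * ((t : ((cmDatum L 2 (Matrix.of fun i j : Fin 2 => if i.val + j.val + 1 = 2 then (1 : L) else 0)).Local v × (cmDatum L 1 (Matrix.of fun i j : Fin 1 => if i.val + j.val + 1 = 1 then (1 : L) else 0)).Local v)).1.val.val : Matrix (Fin 2) (Fin 2) (LocalRing L v)) * P.val) 1 1) w) (𝓝 s) (𝓝 0) := by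
    have h := hc.tendsto s
    rwa [h0] at h
  have hπ' : 0 < ‖π‖ := norm_pos_iff.2 hπ
  filter_upwards [(NormedAddGroup.tendsto_nhds_zero.1 ht) ‖π‖ hπ'] with t ht'
  exact Valued.toNormedField.norm_lt_iff.1 ht'

/-- **ℕ-reading of the depth bound**: for any `π ≠ 0` of `L_w` (e.g. a uniformiser `ϖ_w`) and every `M`, eventually `Valued.v ((τ₀ t − τ₁ t) w) < Valued.v π ^ M` where `τ₀ s = τ₁ s`;
with `Valued.v ((τ₀ t − τ₁ t) w) = Valued.v ϖ_w ^ (N t)` and `Valued.v ϖ_w ≤ 1` this gives `M < N t` by `lt_of_pow_lt_pow_of_le_one`. [cite: Rogawski1990, §4.9 Lemma 4.9.3 (4.9.2) p. 56] -/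
theorem eventually_valued_frameEntry_sub_lt_pow (P : GL (Fin 2) (LocalRing L v)) (w : PlacesOver L v) (t₀ : ((cmDatum L 2 (Matrix.of fun i j : Fin 2 => if i.val + j.val + 1 = 2 then (1 : L) else 0)).Local v × (cmDatum L 1 (Matrix.of fun i j : Fin 1 => if i.val + j.val + 1 = 1 then (1 : L) else 0)).Local v)) (s : ↥(Subgroup.centralizer ({t₀} : Set ((cmDatum L 2 (Matrix.of fun i j : Fin 2 => if i.val + j.val + 1 = 2 then (1 : L) else 0)).Local v × (cmDatum L 1 (Matrix.of fun i j : Fin 1 => if i.val + j.val + 1 = 1 then (1 : L) else 0)).Local v))))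
    (hs : ((P⁻¹).val * ((s : ((cmDatum L 2 (Matrix.of fun i j : Fin 2 => if i.val + j.val + 1 = 2 then (1 : L) else 0)).Local v × (cmDatum L 1 (Matrix.of fun i j : Fin 1 => if i.val + j.val + 1 = 1 then (1 : L) else 0)).Local v)).1.val.val : Matrix (Fin 2) (Fin 2) (LocalRing L v)) * P.val) 0 0 = ((P⁻¹).val * ((s : ((cmDatum L 2 (Matrix.of fun i j : Fin 2 => if i.val + j.val + 1 = 2 then (1 : L) else 0)).Local v × (cmDatum L 1 (Matrix.of fun i j : Fin 1 => if i.val + j.val + 1 = 1 then (1 : L) else 0)).Local v)).1.val.val : Matrix (Fin 2) (Fin 2) (LocalRing L v)) * P.val) 1 1) (π : w.1.adicCompletion L) (hπ : π ≠ 0) (M : ℕ) :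
    ∀ᶠ (t : ↥(Subgroup.centralizer ({t₀} : Set ((cmDatum L 2 (Matrix.of fun i j : Fin 2 => if i.val + j.val + 1 = 2 then (1 : L) else 0)).Local v × (cmDatum L 1 (Matrix.of fun i j : Fin 1 => if i.val + j.val + 1 = 1 then (1 : L) else 0)).Local v)))) in 𝓝 s, Valued.v ((((P⁻¹).val * ((t : ((cmDatum L 2 (Matrix.of fun i j : Fin 2 => if i.val + j.val + 1 = 2 then (1 : L) else 0)).Local v × (cmDatum L 1 (Matrix.of fun i j : Fin 1 => if i.val + j.val + 1 = 1 then (1 : L) else 0)).Local v)).1.val.val : Matrix (Fin 2) (Fin 2) (LocalRing L v)) * P.val) 0 0 - ((P⁻¹).val * ((t : ((cmDatum L 2 (Matrix.of fun i j : Fin 2 => if i.val + j.val + 1 = 2 then (1 : L) else 0)).Local v × (cmDatum L 1 (Matrix.of fun i j : Fin 1 => if i.val + j.val + 1 = 1 then (1 : L) else 0)).Local v)).1.val.val : Matrix (Fin 2) (Fin 2) (LocalRing L v)) * P.val) 1 1) w) < Valued.v π ^ M := by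
  simpa only [map_pow] using eventually_valued_frameEntry_sub_lt L v P w t₀ s hs (π ^ M) (pow_ne_zero M hπ)

/-- **THE DEPTH IS LOCALLY CONSTANT WHERE `τ₀ ≠ τ₁`**: at `s ∈ Z(t₀)` with `τ₀ s ≠ τ₁ s` the valuation `Valued.v ((τ₀ t − τ₁ t) w)` is eventually equal to its value at `s`
(Mathlib `Valued.locally_const` at the non-zero point `(τ₀ s − τ₁ s) w`, non-zero by the one-place reading at a non-split `v`). [cite: Rogawski1990, §4.9 p. 56] [cite: LabesseLanglands1979, §2] -/
theorem eventually_valued_frameEntry_sub_eq (P : GL (Fin 2) (LocalRing L v)) (w : PlacesOver L v) (hw : IsCMField.complexConj L • w.1 = w.1) (t₀ : ((cmDatum L 2 (Matrix.of fun i j : Fin 2 => if i.val + j.val + 1 = 2 then (1 : L) else 0)).Local v × (cmDatum L 1 (Matrix.of fun i j : Fin 1 => if i.val + j.val + 1 = 1 then (1 : L) else 0)).Local v)) (s : ↥(Subgroup.centralizer ({t₀} : Set ((cmDatum L 2 (Matrix.of fun i j : Fin 2 => if i.val + j.val + 1 = 2 then (1 : L) else 0)).Local v × (cmDatum L 1 (Matrix.of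 fun i j : Fin 1 => if i.val + j.val + 1 = 1 then (1 : L) else 0)).Local v))))
    (hs : ((P⁻¹).val * ((s : ((cmDatum L 2 (Matrix.of fun i j : Fin 2 => if i.val + j.val + 1 = 2 then (1 : L) else 0)).Local v × (cmDatum L 1 (Matrix.of fun i j : Fin 1 => if i.val + j.val + 1 = 1 then (1 : L) else 0)).Local v)).1.val.val : Matrix (Fin 2) (Fin 2) (LocalRing L v)) * P.val) 0 0 ≠ ((P⁻¹).val * ((s : ((cmDatum L 2 (Matrix.of fun i j : Fin 2 => if i.val + j.val + 1 = 2 then (1 : L) else 0)).Local v × (cmDatum L 1 (Matrix.of fun i j : Fin 1 => if i.val + j.val + 1 = 1 then (1 : L) else 0)).Local v)).1.val.val : Matrix (Fin 2) (Fin 2) (LocalRing L v)) * P.val) 1 1) :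
    ∀ᶠ (t : ↥(Subgroup.centralizer ({t₀} : Set ((cmDatum L 2 (Matrix.of fun i j : Fin 2 => if i.val + j.val + 1 = 2 then (1 : L) else 0)).Local v × (cmDatum L 1 (Matrix.of fun i j : Fin 1 => if i.val + j.val + 1 = 1 then (1 : L) else 0)).Local v)))) in 𝓝 s, Valued.v ((((P⁻¹).val * ((t : ((cmDatum L 2 (Matrix.of fun i j : Fin 2 => if i.val + j.val + 1 = 2 then (1 : L) else 0)).Local v × (cmDatum L 1 (Matrix.of fun i j : Fin 1 => if i.val + j.val + 1 = 1 then (1 : L) else 0)).Local v)).1.val.val : Matrix (Fin 2) (Fin 2) (LocalRing L v)) * P.val) 0 0 - ((P⁻¹).val * ((t : ((cmDatum L 2 (Matrix.of fun i j : Fin 2 => if i.val + j.val + 1 = 2 then (1 : L) else 0)).Local v × (cmDatum L 1 (Matrix.of fun i j : Fin 1 => if i.val + j.val + 1 = 1 then (1 : L) else 0)).Local v)).1.val.val : Matrix (Fin 2) (Fin 2) (LocalRing L v)) * P.val) 1 1) w) = Valued.v ((((P⁻¹).val * ((s : ((cmDatum L 2 (Matrix.of fun i j : Fin 2 => if i.val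 + j.val + 1 = 2 then (1 : L) else 0)).Local v × (cmDatum L 1 (Matrix.of fun i j : Fin 1 => if i.val + j.val + 1 = 1 then (1 : L) else 0)).Local v)).1.val.val : Matrix (Fin 2) (Fin 2) (LocalRing L v)) * P.val) 0 0 - ((P⁻¹).val * ((s : ((cmDatum L 2 (Matrix.of fun i j : Fin 2 => if i.val + j.val + 1 = 2 then (1 : L) else 0)).Local v × (cmDatum L 1 (Matrix.of fun i j : Fin 1 => if i.val + j.val + 1 = 1 then (1 : L) else 0)).Local v)).1.val.val : Matrix (Fin 2) (Fin 2) (LocalRing L v)) * P.val) 1 1) w) := by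
  have hc := continuous_frameEntry_sub_apply_centralizer L v P w t₀
  have hne : (((P⁻¹).val * ((s : ((cmDatum L 2 (Matrix.of fun i j : Fin 2 => if i.val + j.val + 1 = 2 then (1 : L) else 0)).Local v × (cmDatum L 1 (Matrix.of fun i j : Fin 1 => if i.val + j.val + 1 = 1 then (1 : L) else 0)).Local v)).1.val.val : Matrix (Fin 2) (Fin 2) (LocalRing L v)) * P.val) 0 0 - ((P⁻¹).val * ((s : ((cmDatum L 2 (Matrix.of fun i j : Fin 2 => if i.val + j.val + 1 = 2 then (1 : L) else 0)).Local v × (cmDatum L 1 (Matrix.of fun i j : Fin 1 => if i.val + j.val + 1 = 1 then (1 : L) else 0)).Local v)).1.val.val : Matrix (Fin 2) (Fin 2) (LocalRing L v)) * P.val) 1 1) w ≠ 0 := by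
    rw [Pi.sub_apply, sub_ne_zero]
    exact (localRing_ne_iff_apply_ne L v w hw _ _).1 hs
  have hv : Valued.v ((((P⁻¹).val * ((s : ((cmDatum L 2 (Matrix.of fun i j : Fin 2 => if i.val + j.val + 1 = 2 then (1 : L) else 0)).Local v × (cmDatum L 1 (Matrix.of fun i j : Fin 1 => if i.val + j.val + 1 = 1 then (1 : L) else 0)).Local v)).1.val.val : Matrix (Fin 2) (Fin 2) (LocalRing L v)) * P.val) 0 0 - ((P⁻¹).val * ((s : ((cmDatum L 2 (Matrix.of fun i j : Fin 2 => if i.val + j.val + 1 = 2 then (1 : L) else 0)).Local v × (cmDatum L 1 (Matrix.of fun i j : Fin 1 => if i.val + j.val + 1 = 1 then (1 : L) else 0)).Local v)).1.val.val : Matrix (Fin 2) (Fin 2) (LocalRing L v)) * P.val) 1 1) w) ≠ 0 := (Valuation.ne_zero_iff _).2 hne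
  exact (hc.tendsto s).eventually_mem (Valued.locally_const hv)

/-- **THE `D`-FACTOR `(Π_{w′ ∣ v} ‖(τ₀ t − τ₁ t) w′‖)^{1∕2}` IS EVENTUALLY CONSTANT WHERE `τ₀ ≠ τ₁`** (the product is its factor at the one place `w`,
★ `PlacesOver.prod_eq_of_smul_eq`; the norm is locally constant off `0`) — the `Δ`-half of the `hreg` binder at regular points. [cite: Rogawski1990, §4.9 p. 55–56] -/
theorem eventually_sqrt_prod_norm_frameEntry_sub_eq (P : GL (Fin 2) (LocalRing L v)) (w : PlacesOver L v) (hw : IsCMField.complexConj L • w.1 = w.1) (t₀ : ((cmDatum L 2 (Matrix.of fun i j : Fin 2 => if i.val + j.val + 1 = 2 then (1 : L) else 0)).Local v × (cmDatum L 1 (Matrix.of fun i j : Fin 1 => if i.val + j.val + 1 = 1 then (1 : L) else 0)).Local v)) (s : ↥(Subgroup.centralizer ({t₀} : Set ((cmDatum L 2 (Matrix.of fun i j : Fin 2 => if i.val + j.val + 1 = 2 then (1 : L) else 0)).Local v × (cmDatum L 1 (Matrix.of fun i j : Fin 1 => if i.val + j.val + 1 = 1 then (1 : L) else 0)).Lo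cal v))))
    (hs : ((P⁻¹).val * ((s : ((cmDatum L 2 (Matrix.of fun i j : Fin 2 => if i.val + j.val + 1 = 2 then (1 : L) else 0)).Local v × (cmDatum L 1 (Matrix.of fun i j : Fin 1 => if i.val + j.val + 1 = 1 then (1 : L) else 0)).Local v)).1.val.val : Matrix (Fin 2) (Fin 2) (LocalRing L v)) * P.val) 0 0 ≠ ((P⁻¹).val * ((s : ((cmDatum L 2 (Matrix.of fun i j : Fin 2 => if i.val + j.val + 1 = 2 then (1 : L) else 0)).Local v × (cmDatum L 1 (Matrix.of fun i j : Fin 1 => if i.val + j.val + 1 = 1 then (1 : L) else 0)).Local v)).1.val.val : Matrix (Fin 2) (Fin 2) (LocalRing L v)) * P.val) 1 1) :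
    ∀ᶠ (t : ↥(Subgroup.centralizer ({t₀} : Set ((cmDatum L 2 (Matrix.of fun i j : Fin 2 => if i.val + j.val + 1 = 2 then (1 : L) else 0)).Local v × (cmDatum L 1 (Matrix.of fun i j : Fin 1 => if i.val + j.val + 1 = 1 then (1 : L) else 0)).Local v)))) in 𝓝 s, Real.sqrt (∏ w' : PlacesOver L v, ‖(((P⁻¹).val * ((t : ((cmDatum L 2 (Matrix.of fun i j : Fin 2 => if i.val + j.val + 1 = 2 then (1 : L) else 0)).Local v × (cmDatum L 1 (Matrix.of fun i j : Fin 1 => if i.val + j.val + 1 = 1 then (1 : L) else 0)).Local v)).1.val.val : Matrix (Fin 2) (Fin 2) (LocalRing L v)) * P.val) 0 0 - ((P⁻¹).val * ((t : ((cmDatum L 2 (Matrix.of fun i j : Fin 2 => if i.val + j.val + 1 = 2 then (1 : L) else 0)).Local v × (cmDatum L 1 (Matrix.of fun i j : Fin 1 => if i.val + j.val + 1 = 1 then (1 : L) else 0)).Local v)).1.val.val : Matrix (Fin 2) (Fin 2) (LocalRing L v)) * P.val) 1 1) w'‖) = Real.sqrt (∏ w' : PlacesOver L v, ‖(((P⁻¹).val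 * ((s : ((cmDatum L 2 (Matrix.of fun i j : Fin 2 => if i.val + j.val + 1 = 2 then (1 : L) else 0)).Local v × (cmDatum L 1 (Matrix.of fun i j : Fin 1 => if i.val + j.val + 1 = 1 then (1 : L) else 0)).Local v)).1.val.val : Matrix (Fin 2) (Fin 2) (LocalRing L v)) * P.val) 0 0 - ((P⁻¹).val * ((s : ((cmDatum L 2 (Matrix.of fun i j : Fin 2 => if i.val + j.val + 1 = 2 then (1 : L) else 0)).Local v × (cmDatum L 1 (Matrix.of fun i j : Fin 1 => if i.val + j.val + 1 = 1 then (1 : L) else 0)).Local v)).1.val.val : Matrix (Fin 2) (Fin 2) (LocalRing L v)) * P.val) 1 1) w'‖) := by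
  have hc := continuous_frameEntry_sub_apply_centralizer L v P w t₀
  have hne : (((P⁻¹).val * ((s : ((cmDatum L 2 (Matrix.of fun i j : Fin 2 => if i.val + j.val + 1 = 2 then (1 : L) else 0)).Local v × (cmDatum L 1 (Matrix.of fun i j : Fin 1 => if i.val + j.val + 1 = 1 then (1 : L) else 0)).Local v)).1.val.val : Matrix (Fin 2) (Fin 2) (LocalRing L v)) * P.val) 0 0 - ((P⁻¹).val * ((s : ((cmDatum L 2 (Matrix.of fun i j : Fin 2 => if i.val + j.val + 1 = 2 then (1 : L) else 0)).Local v × (cmDatum L 1 (Matrix.of fun i j : Fin 1 => if i.val + j.val + 1 = 1 then (1 : L) else 0)).Local v)).1.val.val : Matrix (Fin 2) (Fin 2) (LocalRing L v)) * P.val) 1 1) w ≠ 0 := by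
    rw [Pi.sub_apply, sub_ne_zero]
    exact (localRing_ne_iff_apply_ne L v w hw _ _).1 hs
  filter_upwards [(hc.tendsto s).eventually (norm_eventually_eq_of_ne_zero_adicCompletion L w.1 hne)] with t ht
  rw [PlacesOver.prod_eq_of_smul_eq (IsCMField.complexConj L) (IsCMField.complexConj_ne_one L) w hw,
    PlacesOver.prod_eq_of_smul_eq (IsCMField.complexConj L) (IsCMField.complexConj_ne_one L) w hw]
  exact congrArg Real.sqrt ht

/-- **`μ_v(τ₀ t − τ₁ t)` IS EVENTUALLY CONSTANT WHERE `τ₀ ≠ τ₁`** (there `τ₀ s − τ₁ s` is a unit of `E_v`: non-zero at the one place `w`,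
★ `isUnit_localRing_of_ne_zero_of_subsingleton`; then ★ `finHeckeValue_eventually_eq`). [cite: Rogawski1990, §4.9 p. 55–56] -/
theorem finHeckeValue_frameEntry_sub_eventually_eq (P : GL (Fin 2) (LocalRing L v)) (w : PlacesOver L v) (hw : IsCMField.complexConj L • w.1 = w.1) (t₀ : ((cmDatum L 2 (Matrix.of fun i j : Fin 2 => if i.val + j.val + 1 = 2 then (1 : L) else 0)).Local v × (cmDatum L 1 (Matrix.of fun i j : Fin 1 => if i.val + j.val + 1 = 1 then (1 : L) else 0)).Local v))
    (μ : HeckeCharacter L) (s : ↥(Subgroup.centralizer ({t₀} : Set ((cmDatum L 2 (Matrix.of fun i j : Fin 2 => if i.val + j.val + 1 = 2 then (1 : L) else 0)).Local v × (cmDatum L 1 (Matrix.of fun i j : Fin 1 => if i.val + j.val + 1 = 1 then (1 : L) else 0)).Local v)))) (hs : ((P⁻¹).val * ((s : ((cmDatum L 2 (Matrix.of fun i j : Fin 2 => if i.val + j.val + 1 = 2 then (1 : L) else 0)).Local v × (cmDatum L 1 (Matrix.of fun i j : Fin 1 => if i.val + j.val + 1 = 1 then (1 : L) else 0)).Local v)).1.val.val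 : Matrix (Fin 2) (Fin 2) (LocalRing L v)) * P.val) 0 0 ≠ ((P⁻¹).val * ((s : ((cmDatum L 2 (Matrix.of fun i j : Fin 2 => if i.val + j.val + 1 = 2 then (1 : L) else 0)).Local v × (cmDatum L 1 (Matrix.of fun i j : Fin 1 => if i.val + j.val + 1 = 1 then (1 : L) else 0)).Local v)).1.val.val : Matrix (Fin 2) (Fin 2) (LocalRing L v)) * P.val) 1 1) :
    ∀ᶠ (t : ↥(Subgroup.centralizer ({t₀} : Set ((cmDatum L 2 (Matrix.of fun i j : Fin 2 => if i.val + j.val + 1 = 2 then (1 : L) else 0)).Local v × (cmDatum L 1 (Matrix.of fun i j : Fin 1 => if i.val + j.val + 1 = 1 then (1 : L) else 0)).Local v)))) in 𝓝 s, finHeckeValue L v μ (((P⁻¹).val * ((t : ((cmDatum L 2 (Matrix.of fun i j : Fin 2 => if i.val + j.val + 1 = 2 then (1 : L) else 0)).Local v × (cmDatum L 1 (Matrix.of fun i j : Fin 1 => if i.val + j.val + 1 = 1 then (1 : L) else 0)).Local v)).1.val.val : Matrix (Fin 2) (Fin 2) (LocalRing L v)) * P.val) 0 0 - ((P⁻¹).val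 * ((t : ((cmDatum L 2 (Matrix.of fun i j : Fin 2 => if i.val + j.val + 1 = 2 then (1 : L) else 0)).Local v × (cmDatum L 1 (Matrix.of fun i j : Fin 1 => if i.val + j.val + 1 = 1 then (1 : L) else 0)).Local v)).1.val.val : Matrix (Fin 2) (Fin 2) (LocalRing L v)) * P.val) 1 1) = finHeckeValue L v μ (((P⁻¹).val * ((s : ((cmDatum L 2 (Matrix.of fun i j : Fin 2 => if i.val + j.val + 1 = 2 then (1 : L) else 0)).Local v × (cmDatum L 1 (Matrix.of fun i j : Fin 1 => if i.val + j.val + 1 = 1 then (1 : L) else 0)).Local v)).1.val.val : Matrix (Fin 2) (Fin 2) (LocalRing L v)) * P.val) 0 0 - ((P⁻¹).val * ((s : ((cmDatum L 2 (Matrix.of fun i j : Fin 2 => if i.val + j.val + 1 = 2 then (1 : L) else 0)).Local v × (cmDatum L 1 (Matrix.of fun i j : Fin 1 => if i.val + j.val + 1 = 1 then (1 : L) else 0)).Local v)).1.val.val : Matrix (Fin 2) (Fin 2) (LocalRing L v)) * P.val) 1 1) := by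
  haveI : Subsingleton (PlacesOver L v) := PlacesOver.subsingleton_of_smul_eq (IsCMField.complexConj L) (IsCMField.complexConj_ne_one L) w hw
  have hunit : IsUnit (((P⁻¹).val * ((s : ((cmDatum L 2 (Matrix.of fun i j : Fin 2 => if i.val + j.val + 1 = 2 then (1 : L) else 0)).Local v × (cmDatum L 1 (Matrix.of fun i j : Fin 1 => if i.val + j.val + 1 = 1 then (1 : L) else 0)).Local v)).1.val.val : Matrix (Fin 2) (Fin 2) (LocalRing L v)) * P.val) 0 0 - ((P⁻¹).val * ((s : ((cmDatum L 2 (Matrix.of fun i j : Fin 2 => if i.val + j.val + 1 = 2 then (1 : L) else 0)).Local v × (cmDatum L 1 (Matrix.of fun i j : Fin 1 => if i.val + j.val + 1 = 1 then (1 : L) else 0)).Local v)).1.val.val : Matrix (Fin 2) (Fin 2) (LocalRing L v)) * P.val) 1 1) := isUnit_localRing_of_ne_zero_of_subsingleton L v inferInstance (sub_ne_zero.2 hs)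
  exact eventually_eq_comp_of_continuous ((continuous_frameEntry_sub L v P).comp continuous_subtype_val) s (finHeckeValue_eventually_eq L v μ hunit)

end Frame

/-! ## §3 Along the framed torus `Z(t₀)`: norm-one units, regular ⇔ `τ₀ ≠ τ₁`, the `hE` binder, and the `U`-readings of the depth statements -/

section Torus

variable (L : Type) [Field L] [NumberField L] [IsCMField L] (v : HeightOneSpectrum (𝓞 ↥(maximalRealSubfield L)))
  (w : PlacesOver L v) (hw : IsCMField.complexConj L • w.1 = w.1) (t₀ : ((cmDatum L 2 (Matrix.of fun i j : Fin 2 => if i.val + j.val + 1 = 2 then (1 : L) else 0)).Local v × (cmDatum L 1 (Matrix.of fun i j : Fin 1 => if i.val + j.val + 1 = 1 then (1 : L) else 0)).Local v))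
  (P : GL (Fin 2) (LocalRing L v)) (d : Fin 2 → LocalRing L v) (ht₀ : IsRegularElt (t₀.1.val : GL (Fin 2) (LocalRing L v)))
  (hP : (t₀.1.val.val : Matrix (Fin 2) (Fin 2) (LocalRing L v)) * P.val = P.val * Matrix.diagonal d) (hd1 : ∀ i, conjLocal L (IsCMField.complexConj L) v (d i) * d i = 1)

include hw ht₀ hP hd1

/-- **Along `Z(t₀)` every frame eigenvalue `τᵢ t = (P⁻¹ t.1 P)ᵢᵢ` is of norm one**, per index `i` (★ `conjLocal_frameEntry_mul_self`, F0P3-p01 (g13), from ★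
`normOne_frame_of_mem_centralizer`). [cite: Rogawski1990, §3.6 pp. 31–32] -/
theorem conjLocal_frameEntry_mul_self_apply (t : ↥(Subgroup.centralizer ({t₀} : Set ((cmDatum L 2 (Matrix.of fun i j : Fin 2 => if i.val + j.val + 1 = 2 then (1 : L) else 0)).Local v × (cmDatum L 1 (Matrix.of fun i j : Fin 1 => if i.val + j.val + 1 = 1 then (1 : L) else 0)).Local v)))) (i : Fin 2) :
    conjLocal L (IsCMField.complexConj L) v (((P⁻¹).val * ((t : ((cmDatum L 2 (Matrix.of fun i j : Fin 2 => if i.val + j.val + 1 = 2 then (1 : L) else 0)).Local v × (cmDatum L 1 (Matrix.of fun i j : Fin 1 => if i.val + j.val + 1 = 1 then (1 : L) else 0)).Local v)).1.val.val : Matrix (Fin 2) (Fin 2) (LocalRing L v)) * P.val) i i) * ((P⁻¹).val * ((t : ((cmDatum L 2 (Matrix.of fun i j : Fin 2 => if i.val + j.val + 1 = 2 then (1 : L) else 0)).Local v × (cmDatum L 1 (Matrix.of fun i j : Fin 1 => if i.val + j.val + 1 = 1 then (1 : L) else 0)).Local v)).1.val.val : Matrix (Fin 2) (Fin 2) (LocalRing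 L v)) * P.val) i i = 1 := by
  obtain ⟨h0, h1⟩ := conjLocal_frameEntry_mul_self L v w hw t₀ P d ht₀ hP hd1 (t : ((cmDatum L 2 (Matrix.of fun i j : Fin 2 => if i.val + j.val + 1 = 2 then (1 : L) else 0)).Local v × (cmDatum L 1 (Matrix.of fun i j : Fin 1 => if i.val + j.val + 1 = 1 then (1 : L) else 0)).Local v)) t.2
  fin_cases i
  · exact h0
  · exact h1

/-- **The frame eigenvalues are units** of `E_v` (norm one). [cite: Rogawski1990, §3.6 pp. 31–32] -/
theorem isUnit_frameEntry (t : ↥(Subgroup.centralizer ({t₀} : Set ((cmDatum L 2 (Matrix.of fun i j : Fin 2 => if i.val + j.val + 1 = 2 then (1 : L) else 0)).Local v × (cmDatum L 1 (Matrix.of fun i j : Fin 1 => if i.val + j.val + 1 = 1 then (1 : L) else 0)).Local v)))) (i : Fin 2) : IsUnit (((P⁻¹).val * ((t : ((cmDatum L 2 (Matrix.of fun i j : Fin 2 => if i.val + j.val + 1 = 2 then (1 : L) else 0)).Local v × (cmDatum L 1 (Matrix.of fun i j : Fin 1 => if i.val + j.val + 1 = 1 then (1 : L) else 0)).Local v)).1.val.val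 : Matrix (Fin 2) (Fin 2) (LocalRing L v)) * P.val) i i) :=
  isUnit_iff_exists_inv'.2 ⟨_, conjLocal_frameEntry_mul_self_apply L v w hw t₀ P d ht₀ hP hd1 t i⟩

/-- **Along `Z(t₀)`, `t.1` is framed by `P`**: `t.1·P = P·diag(τ₀ t, τ₁ t)` (★ `normOne_frame_of_mem_centralizer`). [cite: Rogawski1990, §3.6 pp. 31–32] -/
theorem frame_of_mem_centralizer (t : ↥(Subgroup.centralizer ({t₀} : Set ((cmDatum L 2 (Matrix.of fun i j : Fin 2 => if i.val + j.val + 1 = 2 then (1 : L) else 0)).Local v × (cmDatum L 1 (Matrix.of fun i j : Fin 1 => if i.val + j.val + 1 = 1 then (1 : L) else 0)).Local v)))) :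
    ((t : ((cmDatum L 2 (Matrix.of fun i j : Fin 2 => if i.val + j.val + 1 = 2 then (1 : L) else 0)).Local v × (cmDatum L 1 (Matrix.of fun i j : Fin 1 => if i.val + j.val + 1 = 1 then (1 : L) else 0)).Local v)).1.val.val : Matrix (Fin 2) (Fin 2) (LocalRing L v)) * P.val = P.val * Matrix.diagonal ![((P⁻¹).val * ((t : ((cmDatum L 2 (Matrix.of fun i j : Fin 2 => if i.val + j.val + 1 = 2 then (1 : L) else 0)).Local v × (cmDatum L 1 (Matrix.of fun i j : Fin 1 => if i.val + j.val + 1 = 1 then (1 : L) else 0)).Local v)).1.val.val : Matrix (Fin 2) (Fin 2) (LocalRing L v)) * P.val) 0 0, ((P⁻¹).val * ((t : ((cmDatum L 2 (Matrix.of fun i j : Fin 2 => if i.val + j.val + 1 = 2 then (1 : L) else 0)).Local v × (cmDatum L 1 (Matrix.of fun i j : Fin 1 => if i.val + j.val + 1 = 1 then (1 : L) else 0)).Local v)).1.val.val : Matrix (Fin 2) (Fin 2) (LocalRing L v)) * P.val) 1 1] :=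
  (normOne_frame_of_mem_centralizer L v w hw t₀ P d ht₀ hP hd1 (t : ((cmDatum L 2 (Matrix.of fun i j : Fin 2 => if i.val + j.val + 1 = 2 then (1 : L) else 0)).Local v × (cmDatum L 1 (Matrix.of fun i j : Fin 1 => if i.val + j.val + 1 = 1 then (1 : L) else 0)).Local v)) t.2).2

/-- **REGULAR ⇔ DISTINCT FRAME EIGENVALUES along `Z(t₀)`**: `t.1` is regular (separable characteristic polynomial) iff `τ₀ t ≠ τ₁ t` — `χ_{t.1} = (X − τ₀ t)(X − τ₁ t)`
(★ `finCharpolyTwo_eq_of_frame`) over the FIELD `E_v = L_w` (non-split `v`, ★ `LocalRing.isField_of_smul_eq`).  So the singular sub-torus `Z(t₀) ∖ U` is `{τ₀ = τ₁}`.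
[cite: Rogawski1990, §3.6 pp. 31–32; §4.9 p. 56] -/
theorem isRegularElt_iff_frameEntry_ne (t : ↥(Subgroup.centralizer ({t₀} : Set ((cmDatum L 2 (Matrix.of fun i j : Fin 2 => if i.val + j.val + 1 = 2 then (1 : L) else 0)).Local v × (cmDatum L 1 (Matrix.of fun i j : Fin 1 => if i.val + j.val + 1 = 1 then (1 : L) else 0)).Local v)))) :
    IsRegularElt ((t : ((cmDatum L 2 (Matrix.of fun i j : Fin 2 => if i.val + j.val + 1 = 2 then (1 : L) else 0)).Local v × (cmDatum L 1 (Matrix.of fun i j : Fin 1 => if i.val + j.val + 1 = 1 then (1 : L) else 0)).Local v)).1.val : GL (Fin 2) (LocalRing L v)) ↔ ((P⁻¹).val * ((t : ((cmDatum L 2 (Matrix.of fun i j : Fin 2 => if i.val + j.val + 1 = 2 then (1 : L) else 0)).Local v × (cmDatum L 1 (Matrix.of fun i j : Fin 1 => if i.val + j.val + 1 = 1 then (1 : L) else 0)).Local v)).1.val.val : Matrix (Fin 2) (Fin 2) (LocalRing L v)) * P.val) 0 0 ≠ ((P⁻¹).val * ((t : ((cmDatum L 2 (Matrix.of fun i j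 : Fin 2 => if i.val + j.val + 1 = 2 then (1 : L) else 0)).Local v × (cmDatum L 1 (Matrix.of fun i j : Fin 1 => if i.val + j.val + 1 = 1 then (1 : L) else 0)).Local v)).1.val.val : Matrix (Fin 2) (Fin 2) (LocalRing L v)) * P.val) 1 1 := by
  classical
  refine ⟨frameEntry_zero_ne_one_of_isRegularElt L v w hw t₀ P d ht₀ hP hd1 (t : ((cmDatum L 2 (Matrix.of fun i j : Fin 2 => if i.val + j.val + 1 = 2 then (1 : L) else 0)).Local v × (cmDatum L 1 (Matrix.of fun i j : Fin 1 => if i.val + j.val + 1 = 1 then (1 : L) else 0)).Local v)) t.2, fun hne => ?_⟩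
  letI : Field (LocalRing L v) := (LocalRing.isField_of_smul_eq (IsCMField.complexConj L) (IsCMField.complexConj_ne_one L) w hw).toField
  have hχ := finCharpolyTwo_eq_of_frame (L := L) (v := v) P (frame_of_mem_centralizer L v w hw t₀ P d ht₀ hP hd1 t)
  have hiff : IsRegularElt ((t : ((cmDatum L 2 (Matrix.of fun i j : Fin 2 => if i.val + j.val + 1 = 2 then (1 : L) else 0)).Local v × (cmDatum L 1 (Matrix.of fun i j : Fin 1 => if i.val + j.val + 1 = 1 then (1 : L) else 0)).Local v)).1.val : GL (Fin 2) (LocalRing L v)) ↔ (finCharpolyTwo L v (t : ((cmDatum L 2 (Matrix.of fun i j : Fin 2 => if i.val + j.val + 1 = 2 then (1 : L) else 0)).Local v × (cmDatum L 1 (Matrix.of fun i j : Fin 1 => if i.val + j.val + 1 = 1 then (1 : L) else 0)).Local v))).Separable := Iff.rfl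
  rw [hiff, hχ]
  exact Polynomial.separable_X_sub_C.mul Polynomial.separable_X_sub_C
    (Polynomial.isCoprime_X_sub_C_of_isUnit_sub (isUnit_iff_ne_zero.2 (sub_ne_zero.2 hne)))

/-- **The depth argument vanishes exactly on the singular sub-torus**: `(τ₀ t − τ₁ t) w = 0 ⇔ t.1` is not regular. [cite: Rogawski1990, §4.9 p. 56] -/
theorem frameEntry_sub_apply_eq_zero_iff_not_isRegularElt (t : ↥(Subgroup.centralizer ({t₀} : Set ((cmDatum L 2 (Matrix.of fun i j : Fin 2 => if i.val + j.val + 1 = 2 then (1 : L) else 0)).Local v × (cmDatum L 1 (Matrix.of fun i j : Fin 1 => if i.val + j.val + 1 = 1 then (1 : L) else 0)).Local v)))) :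
    (((P⁻¹).val * ((t : ((cmDatum L 2 (Matrix.of fun i j : Fin 2 => if i.val + j.val + 1 = 2 then (1 : L) else 0)).Local v × (cmDatum L 1 (Matrix.of fun i j : Fin 1 => if i.val + j.val + 1 = 1 then (1 : L) else 0)).Local v)).1.val.val : Matrix (Fin 2) (Fin 2) (LocalRing L v)) * P.val) 0 0 - ((P⁻¹).val * ((t : ((cmDatum L 2 (Matrix.of fun i j : Fin 2 => if i.val + j.val + 1 = 2 then (1 : L) else 0)).Local v × (cmDatum L 1 (Matrix.of fun i j : Fin 1 => if i.val + j.val + 1 = 1 then (1 : L) else 0)).Local v)).1.val.val : Matrix (Fin 2) (Fin 2) (LocalRing L v)) * P.val) 1 1) w = 0 ↔ ¬ IsRegularElt ((t : ((cmDatum L 2 (Matrix.of fun i j : Fin 2 => if i.val + j.val + 1 = 2 then (1 : L) else 0)).Local v × (cmDatum L 1 (Matrix.of fun i j : Fin 1 => if i.val + j.val + 1 = 1 then (1 : L) else 0)).Local v)).1.val : GL (Fin 2) (LocalRing L v)) := by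
  rw [isRegularElt_iff_frameEntry_ne L v w hw t₀ P d ht₀ hP hd1 t, localRing_ne_iff_apply_ne L v w hw, not_not, Pi.sub_apply, sub_eq_zero]

/-- **`μ_v(τᵢ t)` IS EVENTUALLY CONSTANT AT EVERY `s ∈ Z(t₀)`** (regular or singular): `τᵢ s` is a unit, `μ_v` = ★ `finHeckeValue μ` is constant near every unit
(★ `finHeckeValue_eventually_eq`), and `t ↦ τᵢ t` is continuous (§2). [cite: Rogawski1990, §4.9 pp. 55–56] -/
theorem finHeckeValue_frameEntry_eventually_eq (μ : HeckeCharacter L) (i : Fin 2) (s : ↥(Subgroup.centralizer ({t₀} : Set ((cmDatum L 2 (Matrix.of fun i j : Fin 2 => if i.val + j.val + 1 = 2 then (1 : L) else 0)).Local v × (cmDatum L 1 (Matrix.of fun i j : Fin 1 => if i.val + j.val + 1 = 1 then (1 : L) else 0)).Local v)))) :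
    ∀ᶠ (t : ↥(Subgroup.centralizer ({t₀} : Set ((cmDatum L 2 (Matrix.of fun i j : Fin 2 => if i.val + j.val + 1 = 2 then (1 : L) else 0)).Local v × (cmDatum L 1 (Matrix.of fun i j : Fin 1 => if i.val + j.val + 1 = 1 then (1 : L) else 0)).Local v)))) in 𝓝 s, finHeckeValue L v μ (((P⁻¹).val * ((t : ((cmDatum L 2 (Matrix.of fun i j : Fin 2 => if i.val + j.val + 1 = 2 then (1 : L) else 0)).Local v × (cmDatum L 1 (Matrix.of fun i j : Fin 1 => if i.val + j.val + 1 = 1 then (1 : L) else 0)).Local v)).1.val.val : Matrix (Fin 2) (Fin 2) (LocalRing L v)) * P.val) i i) = finHeckeValue L v μ (((P⁻¹).val * ((s : ((cmDatum L 2 (Matrix.of fun i j : Fin 2 => if i.val + j.val + 1 = 2 then (1 : L) else 0)).Local v × (cmDatum L 1 (Matrix.of fun i j : Fin 1 => if i.val + j.val + 1 = 1 then (1 : L) else 0)).Local v)).1.val.val : Matrix (Fin 2) (Fin 2) (LocalRing L v)) * P.val) i i) :=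
  eventually_eq_comp_of_continuous ((continuous_frameEntry L v P i i).comp continuous_subtype_val) s
    (finHeckeValue_eventually_eq L v μ (isUnit_frameEntry L v w hw t₀ P d ht₀ hP hd1 s i))

/-- **THE `hE` BINDER of ★ `exists_eventually_mul_eq_const_of_depthExpansion`, UNCONDITIONALLY in `U`**: with `E t := μ_v(τᵢ t)⁻¹ · C⁻¹` (architect A-p16 RULING A-9 (b2), `i = 1`),
`E` is eventually constant at every `s ∈ Z(t₀)`; the guarded form `∀ s ∉ U, ∀ᶠ t in 𝓝 s, t ∈ U → E t = E s` is a weakening (`Filter.Eventually.mono`).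
[cite: Rogawski1990, §4.9 Lemma 4.9.3 (4.9.2) p. 56] [cite: LabesseLanglands1979, §2] -/
theorem inv_finHeckeValue_frameEntry_mul_eventually_eq (μ : HeckeCharacter L) (C : ℂ) (i : Fin 2) (s : ↥(Subgroup.centralizer ({t₀} : Set ((cmDatum L 2 (Matrix.of fun i j : Fin 2 => if i.val + j.val + 1 = 2 then (1 : L) else 0)).Local v × (cmDatum L 1 (Matrix.of fun i j : Fin 1 => if i.val + j.val + 1 = 1 then (1 : L) else 0)).Local v)))) :
    ∀ᶠ (t : ↥(Subgroup.centralizer ({t₀} : Set ((cmDatum L 2 (Matrix.of fun i j : Fin 2 => if i.val + j.val + 1 = 2 then (1 : L) else 0)).Local v × (cmDatum L 1 (Matrix.of fun i j : Fin 1 => if i.val + j.val + 1 = 1 then (1 : L) else 0)).Local v)))) in 𝓝 s, (finHeckeValue L v μ (((P⁻¹).val * ((t : ((cmDatum L 2 (Matrix.of fun i j : Fin 2 => if i.val + j.val + 1 = 2 then (1 : L) else 0)).Local v × (cmDatum L 1 (Matrix.of fun i j : Fin 1 => if i.val + j.val + 1 = 1 then (1 : L) else 0)).Local v)).1.val.val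 : Matrix (Fin 2) (Fin 2) (LocalRing L v)) * P.val) i i))⁻¹ * C⁻¹ = (finHeckeValue L v μ (((P⁻¹).val * ((s : ((cmDatum L 2 (Matrix.of fun i j : Fin 2 => if i.val + j.val + 1 = 2 then (1 : L) else 0)).Local v × (cmDatum L 1 (Matrix.of fun i j : Fin 1 => if i.val + j.val + 1 = 1 then (1 : L) else 0)).Local v)).1.val.val : Matrix (Fin 2) (Fin 2) (LocalRing L v)) * P.val) i i))⁻¹ * C⁻¹ := by
  filter_upwards [finHeckeValue_frameEntry_eventually_eq L v w hw t₀ P d ht₀ hP hd1 μ i s] with t ht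
  rw [ht]

/-- **AT A SINGULAR POINT OF THE TORUS** (`s.1` not regular ⇔ `τ₀ s = τ₁ s`) the depth bound holds — the literal `s ∉ U` reading of `hN`: for every `π ≠ 0`,
eventually `Valued.v ((τ₀ t − τ₁ t) w) < Valued.v π`. [cite: Rogawski1990, §4.9 Lemma 4.9.3 (4.9.2) p. 56] -/
theorem eventually_valued_frameEntry_sub_lt_of_not_isRegularElt (s : ↥(Subgroup.centralizer ({t₀} : Set ((cmDatum L 2 (Matrix.of fun i j : Fin 2 => if i.val + j.val + 1 = 2 then (1 : L) else 0)).Local v × (cmDatum L 1 (Matrix.of fun i j : Fin 1 => if i.val + j.val + 1 = 1 then (1 : L) else 0)).Local v)))) (hs : ¬ IsRegularElt ((s : ((cmDatum L 2 (Matrix.of fun i j : Fin 2 => if i.val + j.val + 1 = 2 then (1 : L) else 0)).Local v × (cmDatum L 1 (Matrix.of fun i j : Fin 1 => if i.val + j.val + 1 = 1 then (1 : L) else 0)).Local v)).1.val : GL (Fin 2) (LocalRing L v)))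
    (π : w.1.adicCompletion L) (hπ : π ≠ 0) :
    ∀ᶠ (t : ↥(Subgroup.centralizer ({t₀} : Set ((cmDatum L 2 (Matrix.of fun i j : Fin 2 => if i.val + j.val + 1 = 2 then (1 : L) else 0)).Local v × (cmDatum L 1 (Matrix.of fun i j : Fin 1 => if i.val + j.val + 1 = 1 then (1 : L) else 0)).Local v)))) in 𝓝 s, Valued.v ((((P⁻¹).val * ((t : ((cmDatum L 2 (Matrix.of fun i j : Fin 2 => if i.val + j.val + 1 = 2 then (1 : L) else 0)).Local v × (cmDatum L 1 (Matrix.of fun i j : Fin 1 => if i.val + j.val + 1 = 1 then (1 : L) else 0)).Local v)).1.val.val : Matrix (Fin 2) (Fin 2) (LocalRing L v)) * P.val) 0 0 - ((P⁻¹).val * ((t : ((cmDatum L 2 (Matrix.of fun i j : Fin 2 => if i.val + j.val + 1 = 2 then (1 : L) else 0)).Local v × (cmDatum L 1 (Matrix.of fun i j : Fin 1 => if i.val + j.val + 1 = 1 then (1 : L) else 0)).Local v)).1.val.val : Matrix (Fin 2) (Fin 2) (LocalRing L v)) * P.val) 1 1) w) < Valued.v π := by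
  have hs' : ((P⁻¹).val * ((s : ((cmDatum L 2 (Matrix.of fun i j : Fin 2 => if i.val + j.val + 1 = 2 then (1 : L) else 0)).Local v × (cmDatum L 1 (Matrix.of fun i j : Fin 1 => if i.val + j.val + 1 = 1 then (1 : L) else 0)).Local v)).1.val.val : Matrix (Fin 2) (Fin 2) (LocalRing L v)) * P.val) 0 0 = ((P⁻¹).val * ((s : ((cmDatum L 2 (Matrix.of fun i j : Fin 2 => if i.val + j.val + 1 = 2 then (1 : L) else 0)).Local v × (cmDatum L 1 (Matrix.of fun i j : Fin 1 => if i.val + j.val + 1 = 1 then (1 : L) else 0)).Local v)).1.val.val : Matrix (Fin 2) (Fin 2) (LocalRing L v)) * P.val) 1 1 := by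
    by_contra hne
    exact hs ((isRegularElt_iff_frameEntry_ne L v w hw t₀ P d ht₀ hP hd1 s).2 hne)
  exact eventually_valued_frameEntry_sub_lt L v P w t₀ s hs' π hπ

/-- The ℕ-reading at a singular point: eventually `Valued.v ((τ₀ t − τ₁ t) w) < Valued.v π ^ M` for any `π ≠ 0`, every `M`. [cite: Rogawski1990, §4.9 Lemma 4.9.3 (4.9.2) p. 56] -/
theorem eventually_valued_frameEntry_sub_lt_pow_of_not_isRegularElt (s : ↥(Subgroup.centralizer ({t₀} : Set ((cmDatum L 2 (Matrix.of fun i j : Fin 2 => if i.val + j.val + 1 = 2 then (1 : L) else 0)).Local v × (cmDatum L 1 (Matrix.of fun i j : Fin 1 => if i.val + j.val + 1 = 1 then (1 : L) else 0)).Local v)))) (hs : ¬ IsRegularElt ((s : ((cmDatum L 2 (Matrix.of fun i j : Fin 2 => if i.val + j.val + 1 = 2 then (1 : L) else 0)).Local v × (cmDatum L 1 (Matrix.of fun i j : Fin 1 => if i.val + j.val + 1 = 1 then (1 : L) else 0)).Local v)).1.val : GL (Fin 2) (LocalRing L v)))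
    (π : w.1.adicCompletion L) (hπ : π ≠ 0) (M : ℕ) :
    ∀ᶠ (t : ↥(Subgroup.centralizer ({t₀} : Set ((cmDatum L 2 (Matrix.of fun i j : Fin 2 => if i.val + j.val + 1 = 2 then (1 : L) else 0)).Local v × (cmDatum L 1 (Matrix.of fun i j : Fin 1 => if i.val + j.val + 1 = 1 then (1 : L) else 0)).Local v)))) in 𝓝 s, Valued.v ((((P⁻¹).val * ((t : ((cmDatum L 2 (Matrix.of fun i j : Fin 2 => if i.val + j.val + 1 = 2 then (1 : L) else 0)).Local v × (cmDatum L 1 (Matrix.of fun i j : Fin 1 => if i.val + j.val + 1 = 1 then (1 : L) else 0)).Local v)).1.val.val : Matrix (Fin 2) (Fin 2) (LocalRing L v)) * P.val) 0 0 - ((P⁻¹).val * ((t : ((cmDatum L 2 (Matrix.of fun i j : Fin 2 => if i.val + j.val + 1 = 2 then (1 : L) else 0)).Local v × (cmDatum L 1 (Matrix.of fun i j : Fin 1 => if i.val + j.val + 1 = 1 then (1 : L) else 0)).Local v)).1.val.val : Matrix (Fin 2) (Fin 2) (LocalRing L v)) * P.val) 1 1) w) < Valued.v π ^ M := by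
  simpa only [map_pow] using eventually_valued_frameEntry_sub_lt_of_not_isRegularElt L v w hw t₀ P d ht₀ hP hd1 s hs (π ^ M) (pow_ne_zero M hπ)

/-- **AT A REGULAR POINT OF THE TORUS the depth is locally constant** (the `s ∈ U` reading: «`N` locally constant on `U`»). [cite: Rogawski1990, §4.9 p. 56] -/
theorem eventually_valued_frameEntry_sub_eq_of_isRegularElt (s : ↥(Subgroup.centralizer ({t₀} : Set ((cmDatum L 2 (Matrix.of fun i j : Fin 2 => if i.val + j.val + 1 = 2 then (1 : L) else 0)).Local v × (cmDatum L 1 (Matrix.of fun i j : Fin 1 => if i.val + j.val + 1 = 1 then (1 : L) else 0)).Local v)))) (hs : IsRegularElt ((s : ((cmDatum L 2 (Matrix.of fun i j : Fin 2 => if i.val + j.val + 1 = 2 then (1 : L) else 0)).Local v × (cmDatum L 1 (Matrix.of fun i j : Fin 1 => if i.val + j.val + 1 = 1 then (1 : L) else 0)).Local v)).1.val : GL (Fin 2) (LocalRing L v))) :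
    ∀ᶠ (t : ↥(Subgroup.centralizer ({t₀} : Set ((cmDatum L 2 (Matrix.of fun i j : Fin 2 => if i.val + j.val + 1 = 2 then (1 : L) else 0)).Local v × (cmDatum L 1 (Matrix.of fun i j : Fin 1 => if i.val + j.val + 1 = 1 then (1 : L) else 0)).Local v)))) in 𝓝 s, Valued.v ((((P⁻¹).val * ((t : ((cmDatum L 2 (Matrix.of fun i j : Fin 2 => if i.val + j.val + 1 = 2 then (1 : L) else 0)).Local v × (cmDatum L 1 (Matrix.of fun i j : Fin 1 => if i.val + j.val + 1 = 1 then (1 : L) else 0)).Local v)).1.val.val : Matrix (Fin 2) (Fin 2) (LocalRing L v)) * P.val) 0 0 - ((P⁻¹).val * ((t : ((cmDatum L 2 (Matrix.of fun i j : Fin 2 => if i.val + j.val + 1 = 2 then (1 : L) else 0)).Local v × (cmDatum L 1 (Matrix.of fun i j : Fin 1 => if i.val + j.val + 1 = 1 then (1 : L) else 0)).Local v)).1.val.val : Matrix (Fin 2) (Fin 2) (LocalRing L v)) * P.val) 1 1) w) = Valued.v ((((P⁻¹).val * ((s : ((cmDatum L 2 (Matrix.of fun i j : Fin 2 => if i.val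 + j.val + 1 = 2 then (1 : L) else 0)).Local v × (cmDatum L 1 (Matrix.of fun i j : Fin 1 => if i.val + j.val + 1 = 1 then (1 : L) else 0)).Local v)).1.val.val : Matrix (Fin 2) (Fin 2) (LocalRing L v)) * P.val) 0 0 - ((P⁻¹).val * ((s : ((cmDatum L 2 (Matrix.of fun i j : Fin 2 => if i.val + j.val + 1 = 2 then (1 : L) else 0)).Local v × (cmDatum L 1 (Matrix.of fun i j : Fin 1 => if i.val + j.val + 1 = 1 then (1 : L) else 0)).Local v)).1.val.val : Matrix (Fin 2) (Fin 2) (LocalRing L v)) * P.val) 1 1) w) :=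
  eventually_valued_frameEntry_sub_eq L v P w hw t₀ s ((isRegularElt_iff_frameEntry_ne L v w hw t₀ P d ht₀ hP hd1 s).1 hs)

/-- **AT A REGULAR POINT the whole `Δ`-factor `μ_v(τ₀ t − τ₁ t)⁻¹ · (Π_{w′} ‖(τ₀ t − τ₁ t) w′‖)^{1∕2}` of ★ `rankOneUnstable_core_inert_of_eventually`'s `hEv` is eventually
constant** (the `Δ`-half of the `hreg` binder; the orbital-integral half is the regular local constancy of orbital integrals). [cite: Rogawski1990, §4.9 pp. 55–56] [cite: LabesseLanglands1979, §2] -/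
theorem delta_eventually_eq_of_isRegularElt (μ : HeckeCharacter L) (s : ↥(Subgroup.centralizer ({t₀} : Set ((cmDatum L 2 (Matrix.of fun i j : Fin 2 => if i.val + j.val + 1 = 2 then (1 : L) else 0)).Local v × (cmDatum L 1 (Matrix.of fun i j : Fin 1 => if i.val + j.val + 1 = 1 then (1 : L) else 0)).Local v)))) (hs : IsRegularElt ((s : ((cmDatum L 2 (Matrix.of fun i j : Fin 2 => if i.val + j.val + 1 = 2 then (1 : L) else 0)).Local v × (cmDatum L 1 (Matrix.of fun i j : Fin 1 => if i.val + j.val + 1 = 1 then (1 : L) else 0)).Local v)).1.val : GL (Fin 2) (LocalRing L v))) :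
    ∀ᶠ (t : ↥(Subgroup.centralizer ({t₀} : Set ((cmDatum L 2 (Matrix.of fun i j : Fin 2 => if i.val + j.val + 1 = 2 then (1 : L) else 0)).Local v × (cmDatum L 1 (Matrix.of fun i j : Fin 1 => if i.val + j.val + 1 = 1 then (1 : L) else 0)).Local v)))) in 𝓝 s, ((finHeckeValue L v μ (((P⁻¹).val * ((t : ((cmDatum L 2 (Matrix.of fun i j : Fin 2 => if i.val + j.val + 1 = 2 then (1 : L) else 0)).Local v × (cmDatum L 1 (Matrix.of fun i j : Fin 1 => if i.val + j.val + 1 = 1 then (1 : L) else 0)).Local v)).1.val.val : Matrix (Fin 2) (Fin 2) (LocalRing L v)) * P.val) 0 0 - ((P⁻¹).val * ((t : ((cmDatum L 2 (Matrix.of fun i j : Fin 2 => if i.val + j.val + 1 = 2 then (1 : L) else 0)).Local v × (cmDatum L 1 (Matrix.of fun i j : Fin 1 => if i.val + j.val + 1 = 1 then (1 : L) else 0)).Local v)).1.val.val : Matrix (Fin 2) (Fin 2) (LocalRing L v)) * P.val) 1 1))⁻¹ : ℂ) * ((Real.sqrt (∏ w' : PlacesOver L v, ‖(((P⁻¹).val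 * ((t : ((cmDatum L 2 (Matrix.of fun i j : Fin 2 => if i.val + j.val + 1 = 2 then (1 : L) else 0)).Local v × (cmDatum L 1 (Matrix.of fun i j : Fin 1 => if i.val + j.val + 1 = 1 then (1 : L) else 0)).Local v)).1.val.val : Matrix (Fin 2) (Fin 2) (LocalRing L v)) * P.val) 0 0 - ((P⁻¹).val * ((t : ((cmDatum L 2 (Matrix.of fun i j : Fin 2 => if i.val + j.val + 1 = 2 then (1 : L) else 0)).Local v × (cmDatum L 1 (Matrix.of fun i j : Fin 1 => if i.val + j.val + 1 = 1 then (1 : L) else 0)).Local v)).1.val.val : Matrix (Fin 2) (Fin 2) (LocalRing L v)) * P.val) 1 1) w'‖) : ℝ) : ℂ) =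
      ((finHeckeValue L v μ (((P⁻¹).val * ((s : ((cmDatum L 2 (Matrix.of fun i j : Fin 2 => if i.val + j.val + 1 = 2 then (1 : L) else 0)).Local v × (cmDatum L 1 (Matrix.of fun i j : Fin 1 => if i.val + j.val + 1 = 1 then (1 : L) else 0)).Local v)).1.val.val : Matrix (Fin 2) (Fin 2) (LocalRing L v)) * P.val) 0 0 - ((P⁻¹).val * ((s : ((cmDatum L 2 (Matrix.of fun i j : Fin 2 => if i.val + j.val + 1 = 2 then (1 : L) else 0)).Local v × (cmDatum L 1 (Matrix.of fun i j : Fin 1 => if i.val + j.val + 1 = 1 then (1 : L) else 0)).Local v)).1.val.val : Matrix (Fin 2) (Fin 2) (LocalRing L v)) * P.val) 1 1))⁻¹ : ℂ) * ((Real.sqrt (∏ w' : PlacesOver L v, ‖(((P⁻¹).val * ((s : ((cmDatum L 2 (Matrix.of fun i j : Fin 2 => if i.val + j.val + 1 = 2 then (1 : L) else 0)).Local v × (cmDatum L 1 (Matrix.of fun i j : Fin 1 => if i.val + j.val + 1 = 1 then (1 : L) else 0)).Local v)).1.val.val : Matrix (Fin 2) (Fin 2) (LocalRing L v)) * P.val)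 0 0 - ((P⁻¹).val * ((s : ((cmDatum L 2 (Matrix.of fun i j : Fin 2 => if i.val + j.val + 1 = 2 then (1 : L) else 0)).Local v × (cmDatum L 1 (Matrix.of fun i j : Fin 1 => if i.val + j.val + 1 = 1 then (1 : L) else 0)).Local v)).1.val.val : Matrix (Fin 2) (Fin 2) (LocalRing L v)) * P.val) 1 1) w'‖) : ℝ) : ℂ) := by
  have hne := (isRegularElt_iff_frameEntry_ne L v w hw t₀ P d ht₀ hP hd1 s).1 hs
  filter_upwards [finHeckeValue_frameEntry_sub_eventually_eq L v P w hw t₀ μ s hne, eventually_sqrt_prod_norm_frameEntry_sub_eq L v P w hw t₀ s hne] with t h1 h2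
  rw [h1, h2]

/-- **THE LITERAL `hN` BINDER: at a singular point of the torus the depth `N t := (−log v_w((τ₀ t − τ₁ t)_w)).toNat` (★ `valued_frameEntry_sub_eq_pow`, F0P3-p01 (g13))
exceeds every `M` eventually along the regular locus** — at an UNRAMIFIED non-split `v`: eventually `v_w((τ₀ t − τ₁ t)_w) < v_w(ϖ_w ^ M)` (§2), and at regular `t`
`v_w((τ₀ t − τ₁ t)_w) = v_w(ϖ_w ^ (N t))` with `v_w(ϖ_w) = exp (−1) ≤ 1`, so `M < N t`. [cite: Rogawski1990, §4.9 Lemma 4.9.3 (4.9.2) p. 56] [cite: LabesseLanglands1979, §2] -/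
theorem eventually_lt_depth_of_not_isRegularElt (hunr : Algebra.IsUnramifiedIn (𝓞 L) v.asIdeal) (s : ↥(Subgroup.centralizer ({t₀} : Set ((cmDatum L 2 (Matrix.of fun i j : Fin 2 => if i.val + j.val + 1 = 2 then (1 : L) else 0)).Local v × (cmDatum L 1 (Matrix.of fun i j : Fin 1 => if i.val + j.val + 1 = 1 then (1 : L) else 0)).Local v))))
    (hs : ¬ IsRegularElt ((s : ((cmDatum L 2 (Matrix.of fun i j : Fin 2 => if i.val + j.val + 1 = 2 then (1 : L) else 0)).Local v × (cmDatum L 1 (Matrix.of fun i j : Fin 1 => if i.val + j.val + 1 = 1 then (1 : L) else 0)).Local v)).1.val : GL (Fin 2) (LocalRing L v))) (M : ℕ) :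
    ∀ᶠ (t : ↥(Subgroup.centralizer ({t₀} : Set ((cmDatum L 2 (Matrix.of fun i j : Fin 2 => if i.val + j.val + 1 = 2 then (1 : L) else 0)).Local v × (cmDatum L 1 (Matrix.of fun i j : Fin 1 => if i.val + j.val + 1 = 1 then (1 : L) else 0)).Local v)))) in 𝓝 s, t ∈ {t : ↥(Subgroup.centralizer ({t₀} : Set ((cmDatum L 2 (Matrix.of fun i j : Fin 2 => if i.val + j.val + 1 = 2 then (1 : L) else 0)).Local v × (cmDatum L 1 (Matrix.of fun i j : Fin 1 => if i.val + j.val + 1 = 1 then (1 : L) else 0)).Local v))) | IsRegularElt ((t : ((cmDatum L 2 (Matrix.of fun i j : Fin 2 => if i.val + j.val + 1 = 2 then (1 : L) else 0)).Local v × (cmDatum L 1 (Matrix.of fun i j : Fin 1 => if i.val + j.val + 1 = 1 then (1 : L) else 0)).Local v)).1.val : GL (Fin 2) (LocalRing L v))} →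
      M < (-WithZero.log (Valued.v ((((P⁻¹).val * ((t : ((cmDatum L 2 (Matrix.of fun i j : Fin 2 => if i.val + j.val + 1 = 2 then (1 : L) else 0)).Local v × (cmDatum L 1 (Matrix.of fun i j : Fin 1 => if i.val + j.val + 1 = 1 then (1 : L) else 0)).Local v)).1.val.val : Matrix (Fin 2) (Fin 2) (LocalRing L v)) * P.val) 0 0 - ((P⁻¹).val * ((t : ((cmDatum L 2 (Matrix.of fun i j : Fin 2 => if i.val + j.val + 1 = 2 then (1 : L) else 0)).Local v × (cmDatum L 1 (Matrix.of fun i j : Fin 1 => if i.val + j.val + 1 = 1 then (1 : L) else 0)).Local v)).1.val.val : Matrix (Fin 2) (Fin 2) (LocalRing L v)) * P.val) 1 1) w))).toNat := by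
  have hϖ : Valued.v (toPlace v w (HeckeCharacter.uniformizer ↥(maximalRealSubfield L) v : v.adicCompletion ↥(maximalRealSubfield L))) = WithZero.exp (-1 : ℤ) :=
    Liu2021.LemD1IndexedNonVacuityInertCofinite.valued_toPlace_uniformizer_of_isUnramifiedIn L v hunr w
  have hϖ0 : (toPlace v w (HeckeCharacter.uniformizer ↥(maximalRealSubfield L) v : v.adicCompletion ↥(maximalRealSubfield L))) ≠ 0 := fun h0 => by
    rw [h0, map_zero] at hϖ; exact WithZero.zero_ne_coe hϖ
  have hϖ1 : Valued.v (toPlace v w (HeckeCharacter.uniformizer ↥(maximalRealSubfield L) v : v.adicCompletion ↥(maximalRealSubfield L))) ≤ 1 := by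
    rw [hϖ, ← WithZero.exp_zero, WithZero.exp_le_exp]; decide
  filter_upwards [eventually_valued_frameEntry_sub_lt_pow_of_not_isRegularElt L v w hw t₀ P d ht₀ hP hd1 s hs _ hϖ0 M] with t ht hreg
  rw [valued_frameEntry_sub_eq_pow L v w hw hunr t₀ P d ht₀ hP hd1 (t : ((cmDatum L 2 (Matrix.of fun i j : Fin 2 => if i.val + j.val + 1 = 2 then (1 : L) else 0)).Local v × (cmDatum L 1 (Matrix.of fun i j : Fin 1 => if i.val + j.val + 1 = 1 then (1 : L) else 0)).Local v)) t.2 hreg, map_pow] at ht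
  exact lt_of_pow_lt_pow_of_le_one hϖ1 ht

/-- The `M ≤ N t` form of the `hN` binder (★ `exists_eventually_mul_eq_const_of_depthExpansion`'s literal shape with `U = {t | t.1 regular}` and
`N t = (−log v_w((τ₀ t − τ₁ t)_w)).toNat`). [cite: Rogawski1990, §4.9 Lemma 4.9.3 (4.9.2) p. 56] -/
theorem eventually_le_depth_of_not_isRegularElt (hunr : Algebra.IsUnramifiedIn (𝓞 L) v.asIdeal) (s : ↥(Subgroup.centralizer ({t₀} : Set ((cmDatum L 2 (Matrix.of fun i j : Fin 2 => if i.val + j.val + 1 = 2 then (1 : L) else 0)).Local v × (cmDatum L 1 (Matrix.of fun i j : Fin 1 => if i.val + j.val + 1 = 1 then (1 : L) else 0)).Local v))))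
    (hs : ¬ IsRegularElt ((s : ((cmDatum L 2 (Matrix.of fun i j : Fin 2 => if i.val + j.val + 1 = 2 then (1 : L) else 0)).Local v × (cmDatum L 1 (Matrix.of fun i j : Fin 1 => if i.val + j.val + 1 = 1 then (1 : L) else 0)).Local v)).1.val : GL (Fin 2) (LocalRing L v))) (M : ℕ) :
    ∀ᶠ (t : ↥(Subgroup.centralizer ({t₀} : Set ((cmDatum L 2 (Matrix.of fun i j : Fin 2 => if i.val + j.val + 1 = 2 then (1 : L) else 0)).Local v × (cmDatum L 1 (Matrix.of fun i j : Fin 1 => if i.val + j.val + 1 = 1 then (1 : L) else 0)).Local v)))) in 𝓝 s, t ∈ {t : ↥(Subgroup.centralizer ({t₀} : Set ((cmDatum L 2 (Matrix.of fun i j : Fin 2 => if i.val + j.val + 1 = 2 then (1 : L) else 0)).Local v × (cmDatum L 1 (Matrix.of fun i j : Fin 1 => if i.val + j.val + 1 = 1 then (1 : L) else 0)).Local v))) | IsRegularElt ((t : ((cmDatum L 2 (Matrix.of fun i j : Fin 2 => if i.val + j.val + 1 = 2 then (1 : L) else 0)).Local v × (cmDatum L 1 (Matrix.of fun i j : Fin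 1 => if i.val + j.val + 1 = 1 then (1 : L) else 0)).Local v)).1.val : GL (Fin 2) (LocalRing L v))} →
      M ≤ (-WithZero.log (Valued.v ((((P⁻¹).val * ((t : ((cmDatum L 2 (Matrix.of fun i j : Fin 2 => if i.val + j.val + 1 = 2 then (1 : L) else 0)).Local v × (cmDatum L 1 (Matrix.of fun i j : Fin 1 => if i.val + j.val + 1 = 1 then (1 : L) else 0)).Local v)).1.val.val : Matrix (Fin 2) (Fin 2) (LocalRing L v)) * P.val) 0 0 - ((P⁻¹).val * ((t : ((cmDatum L 2 (Matrix.of fun i j : Fin 2 => if i.val + j.val + 1 = 2 then (1 : L) else 0)).Local v × (cmDatum L 1 (Matrix.of fun i j : Fin 1 => if i.val + j.val + 1 = 1 then (1 : L) else 0)).Local v)).1.val.val : Matrix (Fin 2) (Fin 2) (LocalRing L v)) * P.val) 1 1) w))).toNat :=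
  (eventually_lt_depth_of_not_isRegularElt L v w hw t₀ P d ht₀ hP hd1 hunr s hs M).mono fun _ ht hreg => (ht hreg).le

/-- **On the regular locus the depth `N t = (−log v_w((τ₀ t − τ₁ t)_w)).toNat` is locally constant** (the `N`-half of the `hreg` binder). [cite: Rogawski1990, §4.9 p. 56] -/
theorem eventually_depth_eq_of_isRegularElt (s : ↥(Subgroup.centralizer ({t₀} : Set ((cmDatum L 2 (Matrix.of fun i j : Fin 2 => if i.val + j.val + 1 = 2 then (1 : L) else 0)).Local v × (cmDatum L 1 (Matrix.of fun i j : Fin 1 => if i.val + j.val + 1 = 1 then (1 : L) else 0)).Local v)))) (hs : IsRegularElt ((s : ((cmDatum L 2 (Matrix.of fun i j : Fin 2 => if i.val + j.val + 1 = 2 then (1 : L) else 0)).Local v × (cmDatum L 1 (Matrix.of fun i j : Fin 1 => if i.val + j.val + 1 = 1 then (1 : L) else 0)).Local v)).1.val : GL (Fin 2) (LocalRing L v))) :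
    ∀ᶠ (t : ↥(Subgroup.centralizer ({t₀} : Set ((cmDatum L 2 (Matrix.of fun i j : Fin 2 => if i.val + j.val + 1 = 2 then (1 : L) else 0)).Local v × (cmDatum L 1 (Matrix.of fun i j : Fin 1 => if i.val + j.val + 1 = 1 then (1 : L) else 0)).Local v)))) in 𝓝 s, (-WithZero.log (Valued.v ((((P⁻¹).val * ((t : ((cmDatum L 2 (Matrix.of fun i j : Fin 2 => if i.val + j.val + 1 = 2 then (1 : L) else 0)).Local v × (cmDatum L 1 (Matrix.of fun i j : Fin 1 => if i.val + j.val + 1 = 1 then (1 : L) else 0)).Local v)).1.val.val : Matrix (Fin 2) (Fin 2) (LocalRing L v)) * P.val) 0 0 - ((P⁻¹).val * ((t : ((cmDatum L 2 (Matrix.of fun i j : Fin 2 => if i.val + j.val + 1 = 2 then (1 : L) else 0)).Local v × (cmDatum L 1 (Matrix.of fun i j : Fin 1 => if i.val + j.val + 1 = 1 then (1 : L) else 0)).Local v)).1.val.val : Matrix (Fin 2) (Fin 2) (LocalRing L v)) * P.val) 1 1) w))).toNat = (-WithZero.log (Valued.v ((((P⁻¹).val * ((s : ((cmDatum L 2 (Matrix.of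 fun i j : Fin 2 => if i.val + j.val + 1 = 2 then (1 : L) else 0)).Local v × (cmDatum L 1 (Matrix.of fun i j : Fin 1 => if i.val + j.val + 1 = 1 then (1 : L) else 0)).Local v)).1.val.val : Matrix (Fin 2) (Fin 2) (LocalRing L v)) * P.val) 0 0 - ((P⁻¹).val * ((s : ((cmDatum L 2 (Matrix.of fun i j : Fin 2 => if i.val + j.val + 1 = 2 then (1 : L) else 0)).Local v × (cmDatum L 1 (Matrix.of fun i j : Fin 1 => if i.val + j.val + 1 = 1 then (1 : L) else 0)).Local v)).1.val.val : Matrix (Fin 2) (Fin 2) (LocalRing L v)) * P.val) 1 1) w))).toNat := by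
  filter_upwards [eventually_valued_frameEntry_sub_eq_of_isRegularElt L v w hw t₀ P d ht₀ hP hd1 s hs] with t ht
  rw [ht]

end Torus

end Literature.NumberTheory.Rogawski1990

end
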